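import Mathlib
import Literature.NumberTheory.LFunctions.Zhang2022.Section16BVarpiLocal
import HarnessLib

/-!
# Zhang (2022) §16 p. 93, u034 "trivially `ϖ₂ⱼ(m) = χ(m)ϱ*ⱼ(m) + O(τ₂(m)D^{−c})`": the local ratios
# `F_q(d,l;1−β_j)/F_q(1,1;1−β_j)` at a prime `q ≥ 23` are `1 + O(1/q)` (with the `λ₂(q)`-twist)

Topic `Literature/NumberTheory/LFunctions/Zhang2022` (Landau–Siegel audit tree; verdict-neutral).
Y. Zhang, *Discrete mean estimates and the Landau–Siegel zero*, arXiv:2211.02515v1 (2022)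
[Zhang2022LandauSiegel] — **an unrefereed manuscript under adjudication**; this file PROVES elementary
estimates for the campaign's typed §16 objects and asserts nothing about the manuscript's theorems.
ZHANG-L WP16 (seat zl-w16-p8), Block A of leaf `Eq16_16R2`, node `Z22:§16.u034` in the local reading
`Typed.Section16B.Step16_u034L` (F16B-1) [Z22 p. 93, tex L4615]: "for `(m,𝔮) = 1` and `m < P` we have
trivially `ϖ₂ⱼ(m) = χ(m)ϱ*ⱼ(m) + O(τ₂(m)D^{−c})`". The word "trivially" unpacks to: at a prime `q ∤ 𝔮`
(so `q ≥ D⁴`), each of the three non-generic Euler factors `F_q(d,l;1−β_j)` of `𝓜₂` (flags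
`(q∣d, q∤l)`, `(q∤d, q∣l)`, `(q∣d, q∣l)`), after the twist by `λ₂(q)` when `q ∣ d`, is within `O(1/q)`
of the generic factor `F_q(1,1;1−β_j)`. Kernel-checked here with the crude constant `100`:

* `basic_local_bounds` and `ratio_bounds_abstract` — for complex `A, B, c, λ`
  with `‖A‖ ≤ 3/q`, `‖B‖ ≤ 2/q`, `‖c‖ ≤ 2`, `‖λ‖ ≤ 2`, `‖λ − 1‖ ≤ 3/q`, `q ≥ 23`:
  `1 + λ(cA − B) ≠ 0` and the three twisted ratios `(1+λcA)/(1+λ(cA−B))`, `λ(1+A−B)/(1+λ(cA−B))`,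
  `λ(1+A)/(1+λ(cA−B))` are within `100/q` of `1`;
* `calM2Factor_eq_closedForm` — the Euler factor in closed form (tree: `AppendixA.lamTilde2_prime`,
  `AppendixA.xi2LocalSeries_prime`), all `(d,l)`, `Re s > 0`;
* `norm_lamFlag_mul_locRatio_sub_one_le` — **for every prime `q ≥ 23`, all `d, l`, `j`:
  `‖Λ_q(d)·locRatio q d l (1−β_j) − 1‖ ≤ 100/q`**, `Λ_q(d) = λ₂(q)` if `q ∣ d` else `1`
  (`locRatio = Typed.Section16B.locRatio`, the typer's F16B-1 object; `λ₂(q) = lam2 c′ χ q 1`).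

Uniform in `D`, `χ`, `c′`, `j`: only `|χ(q)| ≤ 1`, `|q^{−β₁}| = 1`, `|q^{−(1−β_j)}| = 1/q` enter.

## References
* Y. Zhang, arXiv:2211.02515v1 (2022), §16 p. 93 (u034), p. 91 (u021), App. A p. 105.
  [cite: Zhang2022LandauSiegel, §16 p. 93 (u034)]
-/

noncomputable section

open Complex Real Finset Filter Topology

namespace Literature.NumberTheory.LFunctions.Zhang2022.Typed.Section16B

open Literature.NumberTheory.LFunctions.Zhang2022
open Literature.NumberTheory.LFunctions.Zhang2022.Skeleton
open Literature.NumberTheory.LFunctions.Zhang2022.Typed.Section16A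
open Literature.NumberTheory.LFunctions.Zhang2022.AppendixA

/-! ## §1. Abstract bookkeeping: inverses and ratios near `1` -/

/-- `‖1 − z‖ ≥ 1 − ‖z‖`. [folklore] -/
private theorem one_sub_norm_le_norm_one_sub (z : ℂ) : 1 - ‖z‖ ≤ ‖1 - z‖ := by
  have h := norm_sub_norm_le (1 : ℂ) z
  rw [norm_one] at h
  linarith

/-- For `‖z‖ ≤ r < 1`: `1 − z ≠ 0` and `‖(1 − z)⁻¹‖ ≤ (1 − r)⁻¹`. [folklore] -/
private theorem norm_inv_one_sub_le {z : ℂ} {r : ℝ} (hz : ‖z‖ ≤ r) (hr : r < 1) :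
    1 - z ≠ 0 ∧ ‖(1 - z)⁻¹‖ ≤ (1 - r)⁻¹ := by
  have h1 : 1 - r ≤ ‖1 - z‖ := by linarith [one_sub_norm_le_norm_one_sub z]
  have hpos : 0 < 1 - r := by linarith
  have hne : 1 - z ≠ 0 := by
    intro h; rw [h, norm_zero] at h1; linarith
  exact ⟨hne, by rw [norm_inv]; exact inv_anti₀ hpos h1⟩

/-- **The three twisted local ratios are `1 + O(1/q)`** (abstract form of u034's "trivially"): for
complex `A, B, c, λ` with `‖A‖ ≤ 3/q`, `‖B‖ ≤ 2/q`, `‖c‖ ≤ 2`, `‖λ‖ ≤ 2`, `‖λ − 1‖ ≤ 3/q` and real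
`q ≥ 23`, the common denominator `1 + λ(cA − B)` is non-zero (indeed of norm `≥ 7/23`) and
`‖(1+λcA)/(1+λ(cA−B)) − 1‖`, `‖λ(1+A−B)/(1+λ(cA−B)) − 1‖`, `‖λ(1+A)/(1+λ(cA−B)) − 1‖ ≤ 100/q`.
[cite: Zhang2022LandauSiegel, §16 p. 93 (u034)] -/
theorem ratio_bounds_abstract {A B c lam : ℂ} {q : ℝ} (hq : 23 ≤ q)
    (hA : ‖A‖ ≤ 3 / q) (hB : ‖B‖ ≤ 2 / q) (hc : ‖c‖ ≤ 2) (hlam : ‖lam‖ ≤ 2)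
    (hlam1 : ‖lam - 1‖ ≤ 3 / q) :
    1 + lam * (c * A - B) ≠ 0 ∧
      ‖(1 + lam * (c * A)) / (1 + lam * (c * A - B)) - 1‖ ≤ 100 / q ∧
      ‖lam * ((1 + (A - B)) / (1 + lam * (c * A - B))) - 1‖ ≤ 100 / q ∧
      ‖lam * ((1 + A) / (1 + lam * (c * A - B))) - 1‖ ≤ 100 / q := by
  have hq0 : 0 < q := by linarith
  have hqi : 1 / q ≤ 1 / 23 := div_le_div_of_nonneg_left (by norm_num) (by norm_num) hq
  -- the perturbation `E = λ(cA − B)` has norm ≤ 16/q ≤ 16/23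
  have hE : ‖lam * (c * A - B)‖ ≤ 16 / q := by
    rw [norm_mul]
    have h1 : ‖c * A - B‖ ≤ 2 * (3 / q) + 2 / q := by
      calc ‖c * A - B‖ ≤ ‖c * A‖ + ‖B‖ := norm_sub_le _ _
        _ ≤ 2 * (3 / q) + 2 / q := by rw [norm_mul]; gcongr
    calc ‖lam‖ * ‖c * A - B‖ ≤ 2 * (2 * (3 / q) + 2 / q) := by gcongr
      _ = 16 / q := by ring
  have hE' : ‖-(lam * (c * A - B))‖ ≤ 16 / 23 := by
    rw [norm_neg]; exact hE.trans (by rw [div_le_div_iff₀ hq0 (by norm_num)]; nlinarith)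
  obtain ⟨hne', hinv⟩ := norm_inv_one_sub_le hE' (by norm_num)
  have hden_eq : 1 - -(lam * (c * A - B)) = 1 + lam * (c * A - B) := by ring
  rw [hden_eq] at hne' hinv
  have hinv' : ‖(1 + lam * (c * A - B))⁻¹‖ ≤ 23 / 7 := hinv.trans (by norm_num)
  refine ⟨hne', ?_, ?_, ?_⟩
  · -- numerator `λB`
    have hnum : (1 + lam * (c * A)) / (1 + lam * (c * A - B)) - 1 =
        (lam * B) * (1 + lam * (c * A - B))⁻¹ := by
      rw [div_sub_one hne', div_eq_mul_inv]
      congr 1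
      ring
    rw [hnum, norm_mul]
    have h1 : ‖lam * B‖ ≤ 2 * (2 / q) := by rw [norm_mul]; gcongr
    calc ‖lam * B‖ * ‖(1 + lam * (c * A - B))⁻¹‖ ≤ 2 * (2 / q) * (23 / 7) := by
          gcongr
      _ = (92 / 7) / q := by ring
      _ ≤ 100 / q := div_le_div_of_nonneg_right (by norm_num) hq0.le
  · -- numerator `(λ − 1) + λA(1 − c)`
    have hnum : lam * ((1 + (A - B)) / (1 + lam * (c * A - B))) - 1 =
        ((lam - 1) + lam * A * (1 - c)) * (1 + lam * (c * A - B))⁻¹ := by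
      rw [← mul_div_assoc, div_sub_one hne', div_eq_mul_inv]
      congr 1
      ring
    rw [hnum, norm_mul]
    have h1 : ‖(lam - 1) + lam * A * (1 - c)‖ ≤ 3 / q + 2 * (3 / q) * 3 := by
      calc ‖(lam - 1) + lam * A * (1 - c)‖ ≤ ‖lam - 1‖ + ‖lam * A * (1 - c)‖ := norm_add_le _ _
        _ ≤ 3 / q + 2 * (3 / q) * 3 := by
            gcongr
            rw [norm_mul, norm_mul]
            gcongr
            calc ‖1 - c‖ ≤ ‖(1 : ℂ)‖ + ‖c‖ := norm_sub_le _ _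
              _ ≤ 1 + 2 := by rw [norm_one]; gcongr
              _ = 3 := by norm_num
    calc ‖(lam - 1) + lam * A * (1 - c)‖ * ‖(1 + lam * (c * A - B))⁻¹‖
        ≤ (3 / q + 2 * (3 / q) * 3) * (23 / 7) := by gcongr
      _ = 69 / q := by ring
      _ ≤ 100 / q := div_le_div_of_nonneg_right (by norm_num) hq0.le
  · -- numerator `(λ − 1) + λA(1 − c) + λB`
    have hnum : lam * ((1 + A) / (1 + lam * (c * A - B))) - 1 =
        ((lam - 1) + lam * A * (1 - c) + lam * B) * (1 + lam * (c * A - B))⁻¹ := by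
      rw [← mul_div_assoc, div_sub_one hne', div_eq_mul_inv]
      congr 1
      ring
    rw [hnum, norm_mul]
    have h1 : ‖(lam - 1) + lam * A * (1 - c) + lam * B‖ ≤ 3 / q + 2 * (3 / q) * 3 + 2 * (2 / q) := by
      calc ‖(lam - 1) + lam * A * (1 - c) + lam * B‖
          ≤ ‖lam - 1‖ + ‖lam * A * (1 - c)‖ + ‖lam * B‖ := norm_add₃_le
        _ ≤ 3 / q + 2 * (3 / q) * 3 + 2 * (2 / q) := by
            gcongr
            · rw [norm_mul, norm_mul]
              gcongr
              calc ‖1 - c‖ ≤ ‖(1 : ℂ)‖ + ‖c‖ := norm_sub_le _ _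
                _ ≤ 1 + 2 := by rw [norm_one]; gcongr
                _ = 3 := by norm_num
            · rw [norm_mul]; gcongr
    calc ‖(lam - 1) + lam * A * (1 - c) + lam * B‖ * ‖(1 + lam * (c * A - B))⁻¹‖
        ≤ (3 / q + 2 * (3 / q) * 3 + 2 * (2 / q)) * (23 / 7) := by gcongr
      _ = (575 / 7) / q := by ring
      _ ≤ 100 / q := div_le_div_of_nonneg_right (by norm_num) hq0.le

/-- **The basic sizes at a prime `q ≥ 23`**: for `‖v‖ ≤ 1`, `‖w‖ ≤ 1`, `‖x‖ ≤ 1/q` (here `v = χ(q)`,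
`w = q^{−β₁}`, `x = q^{−(1−β_j)}`), the four quantities of the closed form of the Euler factor —
`A = (w−1)x/(1−wx)`, `B = (vq/(q−1))·x(1−x)/(1−wx)`, `c = (1 − wv/q)⁻¹`, `λ = λ₂(q) = (1−vw/q)/(1−v/q)` —
satisfy `‖A‖ ≤ 3/q`, `‖B‖ ≤ 2/q`, `‖c‖ ≤ 2`, `‖λ‖ ≤ 2`, `‖λ − 1‖ ≤ 3/q`.
[cite: Zhang2022LandauSiegel, §16 p. 93 (u034), App. A p. 105] -/
theorem basic_local_bounds {v w x : ℂ} {q : ℕ} (hq : 23 ≤ q) (hv : ‖v‖ ≤ 1) (hw : ‖w‖ ≤ 1)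
    (hx : ‖x‖ ≤ (q : ℝ)⁻¹) :
    ‖(w - 1) * x / (1 - w * x)‖ ≤ 3 / q ∧
      ‖v * q / ((q : ℂ) - 1) * (x * (1 - x) / (1 - w * x))‖ ≤ 2 / q ∧
      ‖(1 - w * (v / q))⁻¹‖ ≤ 2 ∧ ‖locLam v w q‖ ≤ 2 ∧ ‖locLam v w q - 1‖ ≤ 3 / q := by
  have hq' : (23 : ℝ) ≤ q := by exact_mod_cast hq
  have hq0 : (0 : ℝ) < q := by linarith
  set t : ℝ := (q : ℝ)⁻¹ with ht
  have ht0 : 0 < t := by positivity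
  have ht23 : t ≤ 1 / 23 := by rw [ht, inv_eq_one_div]; exact div_le_div_of_nonneg_left (by norm_num) (by norm_num) hq'
  have htq : t * q = 1 := by rw [ht]; field_simp
  -- `‖wx‖, ‖x‖, ‖v/q‖, ‖wv/q‖ ≤ t`
  have hwx : ‖w * x‖ ≤ t := by
    rw [norm_mul]; calc ‖w‖ * ‖x‖ ≤ 1 * t := by gcongr
      _ = t := one_mul t
  have hvq : ‖v / (q : ℂ)‖ ≤ t := by
    rw [norm_div, Complex.norm_natCast, ht, div_eq_mul_inv]
    calc ‖v‖ * (q : ℝ)⁻¹ ≤ 1 * (q : ℝ)⁻¹ := by gcongr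
      _ = (q : ℝ)⁻¹ := one_mul _
  have hwvq : ‖w * (v / (q : ℂ))‖ ≤ t := by
    rw [norm_mul]; calc ‖w‖ * ‖v / (q : ℂ)‖ ≤ 1 * t := by gcongr
      _ = t := one_mul t
  have hvwq : ‖v * w / (q : ℂ)‖ ≤ t := by
    rw [show v * w / (q : ℂ) = w * (v / q) by ring]; exact hwvq
  obtain ⟨-, hi_wx⟩ := norm_inv_one_sub_le hwx (by linarith)
  obtain ⟨-, hi_vq⟩ := norm_inv_one_sub_le hvq (by linarith)
  obtain ⟨-, hi_wvq⟩ := norm_inv_one_sub_le hwvq (by linarith)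
  have hinv_t : (1 - t)⁻¹ ≤ 23 / 22 := by
    rw [inv_le_comm₀ (by linarith) (by norm_num)]; linarith
  refine ⟨?_, ?_, ?_, ?_, ?_⟩
  · -- `A`
    rw [div_eq_mul_inv, norm_mul, norm_mul]
    have h1 : ‖w - 1‖ ≤ 2 := by
      calc ‖w - 1‖ ≤ ‖w‖ + ‖(1 : ℂ)‖ := norm_sub_le _ _
        _ ≤ 1 + 1 := by rw [norm_one]; gcongr
        _ = 2 := by norm_num
    calc ‖w - 1‖ * ‖x‖ * ‖(1 - w * x)⁻¹‖ ≤ 2 * t * (23 / 22) := by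
          gcongr
          exact hi_wx.trans hinv_t
      _ ≤ 3 / q := by
          rw [le_div_iff₀ hq0]; nlinarith
  · -- `B`
    have hq1 : (q : ℂ) - 1 ≠ 0 := by
      have : (1 : ℝ) < q := by linarith
      intro h
      have h' : (q : ℂ) = 1 := sub_eq_zero.mp h
      have : (q : ℝ) = 1 := by exact_mod_cast (show (q : ℂ) = (1 : ℂ) from h')
      linarith
    have hqq : ‖(q : ℂ) / ((q : ℂ) - 1)‖ ≤ 23 / 22 := by
      rw [norm_div, Complex.norm_natCast]
      have h1 : ‖(q : ℂ) - 1‖ ≥ (q : ℝ) - 1 := by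
        have := norm_sub_norm_le (q : ℂ) 1
        rw [Complex.norm_natCast, norm_one] at this; linarith
      have h2 : (0 : ℝ) < (q : ℝ) - 1 := by linarith
      calc (q : ℝ) / ‖(q : ℂ) - 1‖ ≤ (q : ℝ) / ((q : ℝ) - 1) :=
            div_le_div_of_nonneg_left hq0.le h2 h1
        _ ≤ 23 / 22 := by rw [div_le_div_iff₀ h2 (by norm_num)]; nlinarith
    have h1x : ‖1 - x‖ ≤ 1 + t := by
      calc ‖1 - x‖ ≤ ‖(1 : ℂ)‖ + ‖x‖ := norm_sub_le _ _
        _ ≤ 1 + t := by rw [norm_one]; gcongr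
    have e : v * q / ((q : ℂ) - 1) * (x * (1 - x) / (1 - w * x)) =
        v * ((q : ℂ) / ((q : ℂ) - 1)) * x * (1 - x) * (1 - w * x)⁻¹ := by
      rw [div_eq_mul_inv, div_eq_mul_inv, div_eq_mul_inv]; ring
    rw [e, norm_mul, norm_mul, norm_mul, norm_mul]
    calc ‖v‖ * ‖(q : ℂ) / ((q : ℂ) - 1)‖ * ‖x‖ * ‖1 - x‖ * ‖(1 - w * x)⁻¹‖
        ≤ 1 * (23 / 22) * t * (1 + t) * (23 / 22) := by
          gcongr
          exact hi_wx.trans hinv_t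
      _ ≤ 2 / q := by
          rw [le_div_iff₀ hq0]; nlinarith
  · -- `c`
    exact hi_wvq.trans (hinv_t.trans (by norm_num))
  · -- `λ`
    unfold locLam
    rw [div_eq_mul_inv, norm_mul]
    have h1 : ‖1 - v * w / (q : ℂ)‖ ≤ 1 + t := by
      calc ‖1 - v * w / (q : ℂ)‖ ≤ ‖(1 : ℂ)‖ + ‖v * w / (q : ℂ)‖ := norm_sub_le _ _
        _ ≤ 1 + t := by rw [norm_one]; gcongr
    calc ‖1 - v * w / (q : ℂ)‖ * ‖(1 - v / (q : ℂ))⁻¹‖ ≤ (1 + t) * (23 / 22) := by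
          gcongr; exact hi_vq.trans hinv_t
      _ ≤ 2 := by nlinarith
  · -- `λ − 1 = v(1 − w)/q · (1 − v/q)⁻¹`
    obtain ⟨hne, -⟩ := norm_inv_one_sub_le hvq (by linarith)
    have e : locLam v w q - 1 = (v / (q : ℂ)) * (1 - w) * (1 - v / (q : ℂ))⁻¹ := by
      unfold locLam
      field_simp
      ring
    rw [e, norm_mul, norm_mul]
    have h1 : ‖1 - w‖ ≤ 2 := by
      calc ‖1 - w‖ ≤ ‖(1 : ℂ)‖ + ‖w‖ := norm_sub_le _ _
        _ ≤ 1 + 1 := by rw [norm_one]; gcongr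
        _ = 2 := by norm_num
    calc ‖v / (q : ℂ)‖ * ‖1 - w‖ * ‖(1 - v / (q : ℂ))⁻¹‖ ≤ t * 2 * (23 / 22) := by
          gcongr; exact hi_vq.trans hinv_t
      _ ≤ 3 / q := by rw [le_div_iff₀ hq0]; nlinarith

/-! ## §2. The Euler factor in closed form, all `(d, l)` -/

section ClosedForm

variable (c' : ℝ) {D : ℕ} (χ : DirichletCharacter ℂ D)

/-- `‖q^{−s}‖ < 1` for a prime `q` and `Re s > 0`. [folklore] -/
private theorem norm_cpow_neg_lt_one' {q : ℕ} (hq : q.Prime) {s : ℂ} (hs : 0 < s.re) :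
    ‖(q : ℂ) ^ (-s)‖ < 1 := by
  rw [Complex.norm_natCast_cpow_of_pos hq.pos, Complex.neg_re]
  exact Real.rpow_lt_one_of_one_lt_of_neg (by exact_mod_cast hq.one_lt) (by linarith)

/-- **The Euler factor `F_q(d,l;s)` of `𝓜₂(d,l;s)` in closed form** (all `d, l`; `q` prime, `Re s > 0`):
with `v = χ(q)`, `w = q^{−β₁}`, `x = q^{−s}`,
`F_q(d,l;s) = locPref v w x · (1 + Λ_d·(c_d(w−1)x/(1−wx) − [q∤l]·(vq/(q−1))·x(1−x)/(1−wx)))`,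
`Λ_d = λ₂(q) = locLam v w q`, `c_d = (1 − wv/q)⁻¹` if `q ∤ d`, both `1` if `q ∣ d`
(tree: `AppendixA.lamTilde2_prime`, `AppendixA.xi2LocalSeries_prime`).
[cite: Zhang2022LandauSiegel, §16 p. 91 (u021), App. A p. 105] -/
theorem calM2Factor_eq_closedForm {q : ℕ} (hq : q.Prime) (d l : ℕ) {s : ℂ} (hs : 0 < s.re) :
    calM2Factor c' χ q d l s =
      locPref (χ (q : ZMod D)) ((q : ℂ) ^ (-beta1 c' D)) ((q : ℂ) ^ (-s)) *
        (1 + (if Nat.Coprime q d then locLam (χ (q : ZMod D)) ((q : ℂ) ^ (-beta1 c' D)) q else 1) *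
          ((if Nat.Coprime q d then (1 - (q : ℂ) ^ (-beta1 c' D) * (χ (q : ZMod D) / q))⁻¹ else 1) *
              ((q : ℂ) ^ (-beta1 c' D) - 1) * (q : ℂ) ^ (-s) /
              (1 - (q : ℂ) ^ (-beta1 c' D) * (q : ℂ) ^ (-s)) -
            (if Nat.Coprime q l then (1 : ℂ) else 0) * (χ (q : ZMod D) * q / ((q : ℂ) - 1)) *
              ((q : ℂ) ^ (-s) * (1 - (q : ℂ) ^ (-s)) /
                (1 - (q : ℂ) ^ (-beta1 c' D) * (q : ℂ) ^ (-s))))) := by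
  have hq0 : (q : ℂ) ≠ 0 := by exact_mod_cast hq.ne_zero
  have hx := norm_cpow_neg_lt_one' hq hs
  unfold calM2Factor locPref
  rw [lamTilde2_prime c' χ hq d, xi2LocalSeries_prime c' χ hq d l s hx, neg_add,
    Complex.cpow_add _ _ hq0]
  ring

/-- `λ₂(q) = lam2 c′ χ q 1` is the tree's `locLam (χ q) (q^{−β₁}) q` ((16.u014) at `s = 1`).
[cite: Zhang2022LandauSiegel, §16 p. 90 (u014)] -/
theorem lam2_prime_one_eq_locLam {q : ℕ} (hq : q.Prime) :
    lam2 c' χ q 1 = locLam (χ (q : ZMod D)) ((q : ℂ) ^ (-beta1 c' D)) q := by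
  rw [← lamTilde2_prime_one c' χ hq]
  unfold lamTilde2
  rw [hq.primeFactors, Finset.filter_singleton, if_pos (Nat.coprime_one_right q), Finset.prod_singleton]

end ClosedForm

/-! ## §3. The twisted local ratios at `s = 1 − β_j` are within `100/q` of `1` -/

section Ratios

variable (c' : ℝ) {D : ℕ} (χ : DirichletCharacter ℂ D)

/-- `Re(1 − β_j) = 1`, so `‖q^{−(1−β_j)}‖ = 1/q` for `q ≥ 1`. [cite: Zhang2022LandauSiegel, §16 (16.10) p. 92] -/
theorem norm_cpow_neg_one_sub_betaJ {q : ℕ} (hq : 0 < q) (j : ℕ) :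
    ‖(q : ℂ) ^ (-(1 - betaJ c' D j))‖ = (q : ℝ)⁻¹ := by
  rw [Complex.norm_natCast_cpow_of_pos hq, Complex.neg_re, one_sub_betaJ_re, Real.rpow_neg_one]

/-- **u034 per prime, kernel form**: for every prime `q ≥ 23`, all `d, l`, `j`, with
`Λ_q(d) = λ₂(q)` if `q ∣ d` and `1` otherwise,
`‖Λ_q(d)·F_q(d,l;1−β_j)/F_q(1,1;1−β_j) − 1‖ ≤ 100/q` — the local content of "trivially
`ϖ₂ⱼ(m) = χ(m)ϱ*ⱼ(m) + O(τ₂(m)D^{−c})`" (§16 p. 93, tex L4615), uniformly in `D, χ, c′` (only `|χ(q)| ≤ 1`,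
`|q^{−β₁}| = 1`, `|q^{−(1−β_j)}| = 1/q` are used; for `q ∤ dl` the ratio is exactly `1`).
[cite: Zhang2022LandauSiegel, §16 p. 93 (u034)] -/
theorem norm_lamFlag_mul_locRatio_sub_one_le {q : ℕ} (hq : q.Prime) (h23 : 23 ≤ q) (d l j : ℕ) :
    ‖(if q ∣ d then lam2 c' χ q 1 else 1) * locRatio c' χ q d l (1 - betaJ c' D j) - 1‖ ≤
      100 / (q : ℝ) := by
  set s : ℂ := 1 - betaJ c' D j with hs
  have hs0 : 0 < s.re := by rw [hs, one_sub_betaJ_re]; norm_num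
  set v : ℂ := χ (q : ZMod D) with hv
  set w : ℂ := (q : ℂ) ^ (-beta1 c' D) with hw
  set x : ℂ := (q : ℂ) ^ (-s) with hx
  have hq0 : (0 : ℝ) < q := by exact_mod_cast hq.pos
  have hq23 : (23 : ℝ) ≤ q := by exact_mod_cast h23
  have hvn : ‖v‖ ≤ 1 := DirichletCharacter.norm_le_one χ _
  have hwn : ‖w‖ ≤ 1 := le_of_eq (norm_cpow_neg_beta1 c' hq.pos).1
  have hxn : ‖x‖ ≤ (q : ℝ)⁻¹ := le_of_eq (norm_cpow_neg_one_sub_betaJ c' hq.pos j)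
  obtain ⟨hA, hB, hc, hlam, hlam1⟩ := basic_local_bounds (v := v) (w := w) (x := x) h23 hvn hwn hxn
  set A : ℂ := (w - 1) * x / (1 - w * x) with hAdef
  set B : ℂ := v * q / ((q : ℂ) - 1) * (x * (1 - x) / (1 - w * x)) with hBdef
  set c : ℂ := (1 - w * (v / q))⁻¹ with hcdef
  set lam : ℂ := locLam v w q with hlamdef
  obtain ⟨hden, h01, h10, h11⟩ := ratio_bounds_abstract hq23 hA hB hc hlam hlam1
  -- the prefactor is non-zero
  have hwx : ‖w * x‖ ≤ (q : ℝ)⁻¹ := by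
    rw [norm_mul]; calc ‖w‖ * ‖x‖ ≤ 1 * (q : ℝ)⁻¹ := by gcongr
      _ = (q : ℝ)⁻¹ := one_mul _
  have hqi : (q : ℝ)⁻¹ < 1 := by rw [inv_lt_one_iff₀]; right; linarith
  have hP : locPref v w x ≠ 0 := by
    unfold locPref
    obtain ⟨h1, -⟩ := norm_inv_one_sub_le hwx hqi
    obtain ⟨h2, -⟩ := norm_inv_one_sub_le hxn hqi
    have hvx : ‖v * x‖ ≤ (q : ℝ)⁻¹ := by
      rw [norm_mul]; calc ‖v‖ * ‖x‖ ≤ 1 * (q : ℝ)⁻¹ := by gcongr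
        _ = (q : ℝ)⁻¹ := one_mul _
    obtain ⟨h3, -⟩ := norm_inv_one_sub_le hvx hqi
    exact div_ne_zero h1 (mul_ne_zero h2 h3)
  -- the closed forms of numerator and denominator
  have h11cf : calM2Factor c' χ q 1 1 s = locPref v w x * (1 + lam * (c * A - B)) := by
    rw [calM2Factor_eq_closedForm c' χ hq 1 1 hs0, if_pos (Nat.coprime_one_right q),
      if_pos (Nat.coprime_one_right q), if_pos (Nat.coprime_one_right q)]
    simp only [hAdef, hBdef, hcdef, hlamdef, hv, hw, hx]
    ring
  have hF11 : calM2Factor c' χ q 1 1 s ≠ 0 := by rw [h11cf]; exact mul_ne_zero hP hden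
  unfold locRatio
  by_cases hqd : q ∣ d
  · have hncd : ¬ Nat.Coprime q d := by rw [hq.coprime_iff_not_dvd]; exact not_not.mpr hqd
    rw [if_pos hqd, lam2_prime_one_eq_locLam c' χ hq]
    by_cases hql : q ∣ l
    · -- flags (1,1): `λ(1+A)/den`
      have hncl : ¬ Nat.Coprime q l := by rw [hq.coprime_iff_not_dvd]; exact not_not.mpr hql
      have hcf : calM2Factor c' χ q d l s = locPref v w x * (1 + A) := by
        rw [calM2Factor_eq_closedForm c' χ hq d l hs0, if_neg hncd, if_neg hncd, if_neg hncl]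
        simp only [hAdef, hv, hw, hx]
        ring
      rw [hcf, h11cf, mul_div_mul_left _ _ hP]
      exact h11
    · -- flags (1,0): `λ(1+A−B)/den`
      have hcl : Nat.Coprime q l := hq.coprime_iff_not_dvd.mpr hql
      have hcf : calM2Factor c' χ q d l s = locPref v w x * (1 + (A - B)) := by
        rw [calM2Factor_eq_closedForm c' χ hq d l hs0, if_neg hncd, if_neg hncd, if_pos hcl]
        simp only [hAdef, hBdef, hv, hw, hx]
        ring
      rw [hcf, h11cf, mul_div_mul_left _ _ hP]
      exact h10
  · have hcd : Nat.Coprime q d := hq.coprime_iff_not_dvd.mpr hqd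
    rw [if_neg hqd, one_mul]
    by_cases hql : q ∣ l
    · -- flags (0,1): `(1+λcA)/den`
      have hncl : ¬ Nat.Coprime q l := by rw [hq.coprime_iff_not_dvd]; exact not_not.mpr hql
      have hcf : calM2Factor c' χ q d l s = locPref v w x * (1 + lam * (c * A)) := by
        rw [calM2Factor_eq_closedForm c' χ hq d l hs0, if_pos hcd, if_pos hcd, if_neg hncl]
        simp only [hAdef, hcdef, hlamdef, hv, hw, hx]
        ring
      rw [hcf, h11cf, mul_div_mul_left _ _ hP]
      exact h01
    · -- flags (0,0): the ratio is `1`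
      have hcl : Nat.Coprime q l := hq.coprime_iff_not_dvd.mpr hql
      rw [calM2Factor_eq_one_one_of_coprime c' χ hq hcd hcl hs0, div_self hF11, sub_self, norm_zero]
      positivity

/-- **Non-vanishing of the generic factor at `s = 1 − β_j` for every prime `q ≥ 23`** (so that the
local ratios are genuine quotients). [cite: Zhang2022LandauSiegel, §16 p. 91 (u021)] -/
theorem calM2Factor_one_one_ne_zero_of_le {q : ℕ} (hq : q.Prime) (h23 : 23 ≤ q) (j : ℕ) :
    calM2Factor c' χ q 1 1 (1 - betaJ c' D j) ≠ 0 := by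
  set s : ℂ := 1 - betaJ c' D j with hs
  have hs0 : 0 < s.re := by rw [hs, one_sub_betaJ_re]; norm_num
  set v : ℂ := χ (q : ZMod D) with hv
  set w : ℂ := (q : ℂ) ^ (-beta1 c' D) with hw
  set x : ℂ := (q : ℂ) ^ (-s) with hx
  have hq0 : (0 : ℝ) < q := by exact_mod_cast hq.pos
  have hq23 : (23 : ℝ) ≤ q := by exact_mod_cast h23
  have hvn : ‖v‖ ≤ 1 := DirichletCharacter.norm_le_one χ _
  have hwn : ‖w‖ ≤ 1 := le_of_eq (norm_cpow_neg_beta1 c' hq.pos).1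
  have hxn : ‖x‖ ≤ (q : ℝ)⁻¹ := le_of_eq (norm_cpow_neg_one_sub_betaJ c' hq.pos j)
  obtain ⟨hA, hB, hc, hlam, hlam1⟩ := basic_local_bounds (v := v) (w := w) (x := x) h23 hvn hwn hxn
  obtain ⟨hden, -, -, -⟩ := ratio_bounds_abstract hq23 hA hB hc hlam hlam1
  have hwx : ‖w * x‖ ≤ (q : ℝ)⁻¹ := by
    rw [norm_mul]; calc ‖w‖ * ‖x‖ ≤ 1 * (q : ℝ)⁻¹ := by gcongr
      _ = (q : ℝ)⁻¹ := one_mul _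
  have hqi : (q : ℝ)⁻¹ < 1 := by rw [inv_lt_one_iff₀]; right; linarith
  have hP : locPref v w x ≠ 0 := by
    unfold locPref
    obtain ⟨h1, -⟩ := norm_inv_one_sub_le hwx hqi
    obtain ⟨h2, -⟩ := norm_inv_one_sub_le hxn hqi
    have hvx : ‖v * x‖ ≤ (q : ℝ)⁻¹ := by
      rw [norm_mul]; calc ‖v‖ * ‖x‖ ≤ 1 * (q : ℝ)⁻¹ := by gcongr
        _ = (q : ℝ)⁻¹ := one_mul _
    obtain ⟨h3, -⟩ := norm_inv_one_sub_le hvx hqi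
    exact div_ne_zero h1 (mul_ne_zero h2 h3)
  have h11cf : calM2Factor c' χ q 1 1 s = locPref v w x *
      (1 + locLam v w q * ((1 - w * (v / q))⁻¹ * ((w - 1) * x / (1 - w * x)) -
        v * q / ((q : ℂ) - 1) * (x * (1 - x) / (1 - w * x)))) := by
    rw [calM2Factor_eq_closedForm c' χ hq 1 1 hs0, if_pos (Nat.coprime_one_right q),
      if_pos (Nat.coprime_one_right q), if_pos (Nat.coprime_one_right q)]
    simp only [hv, hw, hx]
    ring
  rw [h11cf]
  exact mul_ne_zero hP hden

end Ratios

end Literature.NumberTheory.LFunctions.Zhang2022.Typed.Section16B
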